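import Summits.PneNP.PneNP.Theses.Descriptive
import Literature.ModelTheory.FiniteModelTheory.POptimalAndLogicsForPTIMEChenFlumProofs

/-!
# Route Descriptive — support `ThesisGivesNoPOptimalTaut` (stmt-PneNP-14715)

Gurevich's conjecture (no logic captures PTIME on graphs, for every clocked universal machine)
implies that `TAUT` has no p-optimal proof system: Chen–Flum 2010, Cor. 10, contraposed. The fact
`ChenFlum2010_logicForP_of_pOptimalTaut` is PROVED in the tree
(`ChenFlum2010_logicForP_of_pOptimalTaut_holds`), and its contrapositive is
`ChenFlum2010_logicForP_of_pOptimalTaut.no_pOptimalTaut_of_noLogicForP`.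
-/

set_option linter.dupNamespace false -- `Summit.PneNP.PneNP.…`: summit = sub-problem name (D-0017 single-conjunct layout)

namespace Summit.PneNP.PneNP.Theorems

open Literature.ModelTheory.FiniteModelTheory

/-- **Support item `ThesisGivesNoPOptimalTaut` (stmt-PneNP-14715)**:
`DescriptiveThesis → NoPOptimalTaut` — Chen–Flum 2010, Cor. 10 contraposed, over the proved fact
`ChenFlum2010_logicForP_of_pOptimalTaut_holds`. [Chen–Flum 2010, Cor. 10] -/
theorem descriptive_thesisGivesNoPOptimalTaut_proof :
    Summit.PneNP.PneNP.Theses.Descriptive.ThesisGivesNoPOptimalTaut := by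
  unfold Summit.PneNP.PneNP.Theses.Descriptive.ThesisGivesNoPOptimalTaut
    Summit.PneNP.PneNP.Theses.Descriptive.DescriptiveThesis
    Summit.PneNP.PneNP.Theses.Descriptive.NoPOptimalTaut
  exact fun hX =>
    ChenFlum2010_logicForP_of_pOptimalTaut.no_pOptimalTaut_of_noLogicForP
      ChenFlum2010_logicForP_of_pOptimalTaut_holds hX

end Summit.PneNP.PneNP.Theorems
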